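import Mathlib
import Summits.Ventures.PercRepro2.Defs
import Summits.Ventures.PercRepro2.Independence
import Summits.Ventures.PercRepro2.Harris
import Summits.Ventures.PercRepro2.Graph
import Summits.Ventures.PercRepro2.Exploration
import Summits.Ventures.PercRepro2.Events
import Summits.Ventures.PercRepro2.FourFunctions
import Summits.Ventures.PercRepro2.Induced
import Summits.Ventures.PercRepro2.Frontier
import Summits.Ventures.PercRepro2.ObsIndependence
import Summits.Ventures.PercRepro2.BHK
import Summits.Ventures.PercRepro2.BHKEvents
import Summits.Ventures.PercRepro2.MultiSource
import Summits.Ventures.PercRepro2.OrderPreservation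
import Summits.Ventures.PercRepro2.SeedSet
import Summits.Ventures.PercRepro2.MultiSourceFun
import Summits.Ventures.PercRepro2.CrossRootT
import Summits.Ventures.PercRepro2.VdBKahn
import Summits.Ventures.PercRepro2.HullDefs
import Summits.Ventures.PercRepro2.CCTRootEdge
import Summits.Ventures.PercRepro2.R1Rung
import Summits.Ventures.PercRepro2.CC2Rung
import Summits.Ventures.PercRepro2.PASubDefs
import Summits.Ventures.PercRepro2.HalfN
import Summits.Ventures.PercRepro2.CCTLin
import Summits.Ventures.PercRepro2.CCTAvoidedEdge
import Summits.Ventures.PercRepro2.LemmaA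

/-!
# (CC-T⁻) at an edge incident to the avoided set is Lemma A (blind cell PercRepro2, typer-1;
mine-c g3 §10.3 "(CC-T⁻) [T1 ≥ 0]" — the prover target of row 2′CCT-LIN — and MINEC-THEOREMS.md Lemma A)

For `e = {t, w}` with `t ∈ T`, opening `e` makes `s` avoid `T` iff it avoided `T ∪ {w}` with `e` closed
(`CCT.update_true_mem_avoidAll_iff_insert`), so the `e`-open avoidance `R⁺` is the `e`-closed avoidance
of the larger set `T ∪ {w}` and (CC-T⁻) — `E_{μ₀}[(X⁻ − m⁰_X)(Y⁻ − m⁰_Y); R⁺] ≥ 0` — is exactly Lemma A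
(`MineCLemmas.avoidMore_nonneg`) for the weights `p[e ↦ 0]` with the extra avoided set `{w}`:
**`cctMinus_avoided_edge`**. (At a free edge the statement stays open; at a root edge `R⁺` is the
two-seed avoidance `{C(s) ∪ C(w) avoids T}`, not of Lemma A's form.)
-/

namespace Summit.Ventures.PercRepro2

namespace CCTLin

open PASub TwoSetRung

open scoped Classical

variable {V : Type*} {E : Type*} [Fintype E] [DecidableEq E] [Fintype V] [DecidableEq V]
  {R : Type*} [Field R] [LinearOrder R] [IsStrictOrderedRing R]

variable (p : E → R) (ends : E → Sym2 V) (e : E) (s : V) (T : Finset V)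

omit [Fintype V] [DecidableEq V] [LinearOrder R] [IsStrictOrderedRing R] in
/-- The `e`-closed masses as events of `ω`: `massF p₀ = P({ω⁻ ∈ R_T ∩ X_A})`. -/
lemma massF_update_zero_eq (A : Finset V) :
    massF (Function.update p e 0) ends s A T =
      prob p {ω | Function.update ω e false ∈ avoidAll ends s T ∩ connAll ends s A} := by
  unfold massF
  rw [CCT.prob_update_zero_eq]

omit [Fintype V] [DecidableEq V] [LinearOrder R] [IsStrictOrderedRing R] in
/-- `massP p₀ = P({ω⁻ ∈ R_T})`. -/
lemma massP_update_zero_eq :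
    massP (Function.update p e 0) ends s T =
      prob p {ω | Function.update ω e false ∈ avoidAll ends s T} := by
  unfold massP
  rw [CCT.prob_update_zero_eq]

/-- **(CC-T⁻) at an edge incident to the avoided set** (`e = {t, w}`, `t ∈ T`): Lemma A. -/
theorem cctMinus_avoided_edge (hp : IsProbVec p) {t w : V} (hends : ends e = s(t, w)) (ht : t ∈ T)
    (a b : V) : CCTMinus p ends e s T a b := by
  unfold CCTMinus
  have hp₀ : IsProbVec (Function.update p e 0) := hp.update e le_rfl zero_le_one
  have key := MineCLemmas.avoidMore_nonneg (Function.update p e 0) ends hp₀ s {a} {b} T {w}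
  -- rewrite every mass as an event of `ω` under `p`
  simp only [CCT.prob_update_zero_eq] at key
  rw [massP_update_zero_eq, massF_update_zero_eq, massF_update_zero_eq]
  -- identify the `R⁺`-events with the `e`-closed avoidance of `T ∪ {w}`
  have hR : Rplus ends e s T = {ω | Function.update ω e false ∈ avoidAll ends s (insert w T)} := by
    ext ω
    simp only [Rplus, Set.mem_setOf_eq]
    exact CCT.update_true_mem_avoidAll_iff_insert ends hends ω s ht
  have hU : ({w} : Finset V) ∪ T = insert w T := by
    ext x; simp only [Finset.mem_union, Finset.mem_singleton, Finset.mem_insert]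
  have hTU : T ∪ {w} = insert w T := by
    ext x; simp only [Finset.mem_union, Finset.mem_singleton, Finset.mem_insert]; tauto
  rw [hTU] at key
  have e1 : Xminus ends e s a ∩ Xminus ends e s b ∩ Rplus ends e s T =
      {ω | Function.update ω e false ∈ connAll ends s ({a} ∪ {b}) ∩ avoidAll ends s (insert w T)} := by
    rw [hR]
    ext ω
    simp only [Xminus, Set.mem_inter_iff, Set.mem_setOf_eq, connAll, Finset.mem_union,
      Finset.mem_singleton]
    constructor
    · rintro ⟨⟨ha, hb⟩, hR⟩
      refine ⟨fun x hx => ?_, hR⟩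
      rcases hx with rfl | rfl
      · exact ha
      · exact hb
    · rintro ⟨h, hR⟩
      exact ⟨⟨h a (Or.inl rfl), h b (Or.inr rfl)⟩, hR⟩
  have e2 : ∀ c : V, Xminus ends e s c ∩ Rplus ends e s T =
      {ω | Function.update ω e false ∈ connAll ends s {c} ∩ avoidAll ends s (insert w T)} := by
    intro c
    rw [hR]
    ext ω
    simp only [Xminus, Set.mem_inter_iff, Set.mem_setOf_eq, connAll, Finset.mem_singleton, forall_eq]
  have e3 : ∀ c : V, {ω | Function.update ω e false ∈ avoidAll ends s T ∩ connAll ends s {c}} =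
      {ω | Function.update ω e false ∈ connAll ends s {c} ∩ avoidAll ends s T} := by
    intro c
    ext ω
    simp only [Set.mem_setOf_eq, Set.mem_inter_iff]
    tauto
  have e4 : Rplus ends e s T = {ω | Function.update ω e false ∈ avoidAll ends s (insert w T)} := hR
  rw [e1, e2, e2, e3, e3, e4]
  exact key

end CCTLin

end Summit.Ventures.PercRepro2
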